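import Summits.Ventures.PercRepro.C041PendantCone
import Summits.Ventures.PercRepro.C041GlueFold
import Summits.Ventures.PercRepro.C041TriangleCone

/-!
# ROW C-041 — THE EDGE DICTIONARY: hanging a zone by one edge applies mine-3's `ℓψ` to its six-vector (p6, gen 31;
C-041.md §15 (c), §19 (b) — the tree recursion `ℓ` on the graph model, at the level of six-vectors)

THEOREM (PENDANT ZONE) in six-vector form (`Pendant.sixVec_pendant`, g29) reads `Π(Z₁ ∪_u Z₂) = x·ℓ(ψΠ₂) + z·Π₂ +
w·n′·𝟙` with the counts `x`, `z`, `w` of the colourings of the host by the status of the junction.  For the host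
`K₂` (one edge, the zone at its far end, the anchor at the near end) the blue colouring is merged and unreached,
the red one separated and reached: `x = 1`, `z = w = 0`.  Hence

* **`sixVec_edgePendant`** — `Π((edgePendant A).Z) = ellv (Π A.Z)`: hanging a package by one edge IS mine-3's
  `ℓψ` (`ellv w = ell (w 0) (w 1 − w 0) (w 2 − w 0) (w 4 + w 5 − w 3)`, `C041TriangleCone`), and
* `ellv_sixVec` — `ellv (Π Z) = ell #F #T₁ #T₂ #I` (the six-vector's root 4-vector).

With `AnchorGlue.sixVec_glue` (Π multiplicative at the anchor) and `sixVec_pointZone`, the six-vector of every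
tree model `treeModel t` of `C041GlueFold` is the iterated `ℓψ` of mine-3's tree recursion (`C041TreeDict`); and
every «tree term» of mine-3's square reduction `thetaSq_eq` (`ℓψ(w₃ℓψ(w₂ℓψ(w₁)))` …) is the six-vector of an
explicit path zone.
-/

namespace PercRepro

namespace ZoneZ

open ZoneData TreeClosure Pendant Finset

/-! ## `ellv` of a six-vector -/

variable {V E T₁ T₂ : Type} (Z : ZoneData V E T₁ T₂) (k : V) [Fintype E] [DecidableEq E] [Fintype T₁]
  [DecidableEq T₁] [Fintype T₂] [DecidableEq T₂]

/-- `ℓψ` of the six-vector is `ℓ` of the four counts `(F, T₁, T₂, I)`. -/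
theorem ellv_sixVec :
    ellv (Z.sixVec k) = ell (#(Z.Fset k)) (#(Z.T1set k)) (#(Z.T2set k)) (#(Z.Iset k)) := by
  unfold ellv
  rw [sixVec_zero, sixVec_one, sixVec_two, sixVec_three, sixVec_four, sixVec_five, card_FAset, card_FBset]
  have h := card_Iset_add_IFset Z k
  have h' : (#(Z.IAset k) : ℝ) + #(Z.IBset k) - #(Z.IFset k) = #(Z.Iset k) := by
    have := congrArg (fun n : ℕ => (n : ℝ)) h
    push_cast at this
    linarith
  rw [h']
  push_cast
  ring_nf

/-! ## The host `K₂` -/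

/-- On `K₂`, the far end is merged iff the edge is blue. -/
theorem K₂_Mg_iff (ω : Unit → Bool) : AZone.K₂.Mg false true ω ↔ ω () = false := by
  constructor
  · intro h
    have key : reach (AZone.K₂.BlueAdjE ω) {false} ⊆ {x : Bool | x = false ∨ ω () = false} := by
      refine reach_subset_of_closed ?_ ?_
      · intro x hx
        rw [Set.mem_singleton_iff] at hx
        exact Or.inl hx
      · rintro x y _ ⟨e, _, he⟩
        exact Or.inr he
    rcases key h with h | h
    · exact absurd h (by decide)
    · exact h
  · intro h
    exact ⟨false, rfl, Relation.ReflTransGen.single ⟨(), Or.inl ⟨rfl, rfl⟩, h⟩⟩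

/-- On `K₂`, the far end is reached iff the edge is red. -/
theorem K₂_Rd_iff (ω : Unit → Bool) : AZone.K₂.Rd false true ω ↔ ω () = true := by
  constructor
  · intro h
    have key : reach (AZone.K₂.RedAdjE ω) {false} ⊆ {x : Bool | x = false ∨ ω () = true} := by
      refine reach_subset_of_closed ?_ ?_
      · intro x hx
        rw [Set.mem_singleton_iff] at hx
        exact Or.inl hx
      · rintro x y _ ⟨e, _, he⟩
        exact Or.inr he
    rcases key h with h | h
    · exact absurd h (by decide)
    · exact h
  · intro h
    exact ⟨false, rfl, Relation.ReflTransGen.single ⟨(), Or.inl ⟨rfl, rfl⟩, h⟩⟩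

/-- The blue colouring is the only merged-and-unreached one. -/
theorem xCount_K₂ : xCount AZone.K₂ true false = 1 := by
  classical
  unfold xCount
  rw [Finset.card_eq_one]
  refine ⟨fun _ => false, ?_⟩
  ext ω
  rw [Finset.mem_filter, Finset.mem_singleton, K₂_Mg_iff, K₂_Rd_iff]
  simp only [Finset.mem_univ, true_and, Bool.not_eq_true]
  constructor
  · rintro ⟨h, -⟩
    funext u
    cases u
    exact h
  · rintro rfl
    exact ⟨rfl, rfl⟩

/-- No colouring is merged and reached. -/
theorem zCount_K₂ : zCount AZone.K₂ true false = 0 := by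
  classical
  unfold zCount
  rw [Finset.card_eq_zero, Finset.filter_eq_empty_iff]
  intro ω _
  rw [K₂_Mg_iff, K₂_Rd_iff]
  rintro ⟨h, h'⟩
  rw [h] at h'
  exact Bool.false_ne_true h'

/-- No colouring is separated and unreached. -/
theorem wCount_K₂ : wCount AZone.K₂ true false = 0 := by
  classical
  unfold wCount
  rw [Finset.card_eq_zero, Finset.filter_eq_empty_iff]
  intro ω _
  rw [K₂_Mg_iff, K₂_Rd_iff]
  rintro ⟨h, h'⟩
  cases hω : ω ()
  · exact h hω
  · exact h' hω

/-! ## THE EDGE DICTIONARY -/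

/-- **THE EDGE DICTIONARY**: hanging a zone by one edge applies `ℓψ` to its six-vector. -/
theorem sixVec_edgePendant :
    (pendant AZone.K₂ true Z k).sixVec (Sum.inl false) = ellv (Z.sixVec k) := by
  rw [sixVec_pendant, xCount_K₂, zCount_K₂, wCount_K₂, ellv_sixVec]
  simp only [Nat.cast_one, one_smul, Nat.cast_zero, zero_smul, add_zero, zero_mul]

/-- The edge dictionary on a packaged zone (`AZone.edgePendant`). -/
theorem sixVec_edgePendant_pkg (A : AZone) [Fintype A.E] [DecidableEq A.E] [Fintype A.T₁] [DecidableEq A.T₁]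
    [Fintype A.T₂] [DecidableEq A.T₂] :
    (AZone.edgePendant A).Z.sixVec (AZone.edgePendant A).k = ellv (A.Z.sixVec A.k) :=
  sixVec_edgePendant A.Z A.k

end ZoneZ

end PercRepro
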